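import Summits.Parity.GeneralizedHardyLittlewood.Theses.LeeYangFibres
import Summits.Parity.GeneralizedHardyLittlewood.Theorems.LeeYangFibresCellsToRelativeDimOne
import Summits.Parity.GeneralizedHardyLittlewood.Theorems.LeeYangFibresModelCellFacts
import Summits.Parity.GeneralizedHardyLittlewood.Theorems.LeeYangFibresHyperbolicityClipsParity
import HarnessLib

/-!
# Route `LeeYangFibres`, item `Assembly` (stmt-Parity-14612): the frame

`Assembly := CellParityLaw → FibreHyperbolicity → AbsoluteUpgrade → GeneralizedHardyLittlewood` is the
statement that the route's two mechanism cruxes and its declared residual imply the sub-problem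
Statement. Its proof obligation is exactly the composition, as in the deciding theorem `closes`, of
the four routine supports

* `ModelCellFacts` (stmt-Parity-14111, Ω-cell anatomy of rough integers),
* `HyperbolicityClipsParity` (stmt-Parity-14114, Newton + multilinear interpolation clipping lemma),
* `CellsToRelativeDimOne` (stmt-Parity-14115, partial summation + PNT) — PROVED in the tree
  (`LeeYangFibresCells.cellsToRelativeDimOne_proof`),
* `FibrationLemma` (stmt-Parity-0822, `DimOne → GeneralizedHardyLittlewood`, Green–Tao fibration, shared).

This file records the frame sorry-free: `assembly_of_supports` reduces `Assembly` to the three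
supports that are still open, consuming the proved `CellsToRelativeDimOne`. When the remaining
supports land, `Assembly` follows by one application (their `_holds`/`_proof` theorems substituted).

References: B. Green, T. Tao, *Linear equations in primes*, Ann. of Math. 171 (2010), Conj. 1.2 / 1.4
[GreenTao2010]; E. Bombieri, *The asymptotic sieve* (1976) [BombieriAsymptoticSieve1976].
-/

namespace Summit.Parity.GeneralizedHardyLittlewood.Theorems.LeeYangFibresAssembly

open Summit.Parity.GeneralizedHardyLittlewood.Theses.LeeYangFibres
  (Assembly ModelCellFacts HyperbolicityClipsParity CellsToRelativeDimOne FibrationLemma)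
open Summit.Parity.GeneralizedHardyLittlewood.Theorems.LeeYangFibresCells (cellsToRelativeDimOne_proof)

/-- **The frame of `Assembly`, general form.** The four routine supports of route `LeeYangFibres`
compose to `Assembly`, exactly as in the deciding theorem `closes`:
`hF (hU (hD (hC hL hH hM)))` — the clipping lemma turns `CellParityLaw`, `FibreHyperbolicity` and
`ModelCellFacts` into `PrimeCellsRelative`, partial summation gives `RelativeDimOne`, the residual
`AbsoluteUpgrade` gives `DimOne`, and the fibration lemma gives `GeneralizedHardyLittlewood`.
Pure logic. -/
theorem assembly_of_four_supports (hM : ModelCellFacts) (hC : HyperbolicityClipsParity)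
    (hD : CellsToRelativeDimOne) (hF : FibrationLemma) : Assembly :=
  fun hL hH hU => hF (hU (hD (hC hL hH hM)))

/-- **The frame of `Assembly`, current form.** With `CellsToRelativeDimOne` proved in the tree
(`LeeYangFibresCells.cellsToRelativeDimOne_proof`, stmt-Parity-14115), `Assembly` is reduced to the
three supports still open: `ModelCellFacts` (stmt-Parity-14111), `HyperbolicityClipsParity`
(stmt-Parity-14114) and the shared `FibrationLemma` (stmt-Parity-0822). -/
theorem assembly_of_supports (hM : ModelCellFacts) (hC : HyperbolicityClipsParity)
    (hF : FibrationLemma) : Assembly :=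
  assembly_of_four_supports hM hC cellsToRelativeDimOne_proof hF

/-- **The frame of `Assembly`, reduced to the fibration lemma.** With `ModelCellFacts`
(stmt-Parity-14111, `Theorems.modelCellFacts_proof`) and `HyperbolicityClipsParity`
(stmt-Parity-14114, `Theorems.HyperbolicityClipsParity_proof`) now proved in the tree (2026-08-16),
`Assembly` is reduced to the ONE support still open, the shared fibration lemma
`FibrationLemma : DimOne → GeneralizedHardyLittlewood` (stmt-Parity-0822): the item closes by
`assembly_of_fibrationLemma FibrationLemma_pf`. -/
theorem assembly_of_fibrationLemma (hF : FibrationLemma) : Assembly :=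
  assembly_of_supports Summit.Parity.GeneralizedHardyLittlewood.Theorems.modelCellFacts_proof
    Summit.Parity.GeneralizedHardyLittlewood.Theorems.HyperbolicityClipsParity_proof hF

end Summit.Parity.GeneralizedHardyLittlewood.Theorems.LeeYangFibresAssembly
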